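import Summits.BirchSwinnertonDyer.BirchSwinnertonDyer.Theorems.ByReductionTypeAtTwoSupersingularUniformFlatLine
import Summits.BirchSwinnertonDyer.BirchSwinnertonDyer.Theorems.ByReductionTypeAtTwoSupersingularIwasawaTwistDualPair
import Summits.BirchSwinnertonDyer.Rank1Residual.Supersingular.BlindPointLever
import Literature.NumberTheory.EllipticCurves.Sprung2024.ChromaticSmallControlProofs
import Literature.NumberTheory.EllipticCurves.IwasawaAlgebraSemilinearCharIdealProofs
import Literature.NumberTheory.EllipticCurves.IwasawaEulerCharRankZeroProofs
import HarnessLib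

/-!
# Route `ByReductionTypeAtTwo` (rung K4), crux `SupersingularRankZeroAtTwo` (item stmt-BirchSwinnertonDyer-19097):
# K67-EC PROVED — the Γ-Euler characteristic of Sprung's `X♭(E/ℚ_∞)` at the ORDER-2 character (`T = −2`)
# (seat `bsd-2adic-ss-1`, GEN 17; brick [D] — the application; closes the EC conjunct of stub 4 `stub_ECNF`
# of the alternative line `Cruxes/SupersingularRankZeroAtTwo/Lines/odd_blind_package.lean` v2.2)

HONEST FRAMING (cell `bsd-2adic`, run/shared/lean/pub/bsd-2adic/): THEOREMS ONLY; no definition, no named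
fact, no `sorry`, no instance; pure Iwasawa-module algebra over the tree's Pontryagin-dual datum — nothing
about `L`-functions; nothing booked; BSD is not proved by any of this. PARTITION (D-0054): X5@2 good-ss r₀
block (generic-odd locus 486/757) × p = 2 — types-the-object-of (one conjunct of a registered-candidate stub
becomes a theorem); closes none. bears_on: K4 (route-BirchSwinnertonDyer-ByReductionTypeAtTwo item 19097).

## What is proved

`OddBlindEC.flatBlindEulerCharAtTwo` — **VERBATIM the body of `OddBlindPackage.FlatBlindEulerCharAtTwo`**
(K67-EC, l.268–288 of the line file v2.2 97ed30da576d818e; a Theorems file cannot import a `Cruxes/…/Lines`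
file, so the statement is restated unfolded — definitionally equal, `exact` closes the line's conjunct): for
every good-supersingular `W` at `2`, cyclotomic `(κ, γ)`, `v ∋ 2`, local data `(g, c)`, every ♭ dual Selmer
datum `D` (f.g., torsion, `char X♭ = (f)`): if `Sel♭_∞[γ+1]` and `Sel♭_∞/(γ+1)` are finite then
`f(−2) ≠ 0` and `v₂ f(−2) = v₂ #Sel♭_∞[γ+1] − v₂ #Sel♭_∞/(γ+1)`.

PROOF = Greenberg's Lemma 4.2 (tree: `IwasawaDual.IsDualPair.constantCoeff_charGenerator_mul_natCard_endCoinvariants`,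
`…order_charGenerator_eq_zero_of_finite_endInvariants`, ANY dual pair) applied to the dual pair TWISTED by the
translation `τ₂ : T ↦ T + 2` (GEN 17 bricks: `IwasawaTranslation.translate`/`translateEquiv`,
`IwasawaTranslation.isDualPair_twisted` — `T + 2 ↔ (conj_γ − 1) + 2 = conj_γ + 1`, local nilpotence because
`p = 2`), starting from the tree's `SharpFlatSelmerDualData.isDualPair` (Sprung 2024 chromatic control file);
the characteristic ideal of the twisted module is `τ_{−2}(char X♭)` by the tree's transport
`Module.charIdeal_eq_map_of_semilinearEquiv` (bsd-wall), and its generator's constant term is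
`(τ_{−2} f)(0) = Σ f_d (−2)^d = BlindLever.evalAt (−2) f` (`IwasawaTranslation.constantCoeff_translate`).
No arithmetic input: true for every f.g. torsion `X♭`, finite submodules included.

References: R. Greenberg, LNM 1716 (1999), §4 Lemma 4.2 [cite: GreenbergLNM1716, §4 Lemma 4.2];
J. Coates, P. Schneider, R. Sujatha, Doc. Math. Extra Vol. Kato (2003), §3 (30)–(31)
[cite: CoatesSchneiderSujatha2003, §3 (30)–(31) p. 199]; B. Mazur, J. Tate, J. Teitelbaum, Invent. Math. 84
(1986), §I.14 [cite: MazurTateTeitelbaum1986Invent, §I.14].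
-/

set_option autoImplicit false
-- the Theorems namespace of this sub repeats the summit name by design (D-0017 nested layout)
set_option linter.dupNamespace false

noncomputable section

open scoped Classical MatrixGroups ModularForm NumberField
open NumberField IsDedekindDomain CongruenceSubgroup WeierstrassCurve Literature.NumberTheory.EllipticCurves
  Literature.NumberTheory.EllipticCurves.ModularForms Literature.NumberTheory.EllipticCurves.Sprung2017
  Literature.NumberTheory.EllipticCurves.Sprung2012
  Literature.NumberTheory.EllipticCurves.Rank1Residual Literature.NumberTheory.EllipticCurves.Rank1Residual.Typed
  Literature.NumberTheory.EllipticCurves.Kobayashi2003 Literature.NumberTheory.EllipticCurves.IwasawaDual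
  Literature.NumberTheory.GaloisRepresentations
  ZpExtension Summit.BirchSwinnertonDyer.Rank1Residual Summit.BirchSwinnertonDyer.Rank1Residual.Supersingular
  Summit.BirchSwinnertonDyer.Rank1Residual.Supersingular.BlindLever Summit.BirchSwinnertonDyer.Rank1Residual.X5.O1

namespace Summit.BirchSwinnertonDyer.BirchSwinnertonDyer.Theorems

namespace OddBlindEC

open IwasawaTranslation

/-! ### `p`-adic valuation bookkeeping -/

/-- `v_p(n) = padicValNat p n` for a natural number read in `ℤ_p`. [folklore] -/
theorem valuation_natCast {p : ℕ} [Fact p.Prime] (n : ℕ) : ((n : ℤ_[p])).valuation = padicValNat p n := by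
  have h : (((n : ℤ_[p]) : ℚ_[p])).valuation = ((n : ℤ_[p]).valuation : ℤ) := PadicInt.valuation_coe _
  rw [PadicInt.coe_natCast, Padic.valuation_natCast] at h
  exact_mod_cast h.symm

/-- Units of `ℤ_p` have valuation `0`. [folklore] -/
theorem valuation_units {p : ℕ} [Fact p.Prime] (u : ℤ_[p]ˣ) : (u : ℤ_[p]).valuation = 0 := by
  have h1 : ‖(u : ℤ_[p])‖ = 1 := PadicInt.isUnit_iff.mp u.isUnit
  rw [PadicInt.norm_eq_zpow_neg_valuation (Units.ne_zero u)] at h1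
  have hp : (1 : ℝ) < p := by exact_mod_cast (Fact.out : p.Prime).one_lt
  have h2 := (zpow_eq_one_iff_right₀ (zero_le_one.trans hp.le) hp.ne').mp h1
  omega

/-! ### K67-EC -/

/-- **K67-EC `FlatBlindEulerCharAtTwo` (the Λ-algebra of `X♭` at the blind character) — PROVED.**
For every ♭ dual Selmer datum `X♭` at `2` (f.g., torsion, `char = (f)`): if the `ψ₂`-anti-invariants
`Sel♭_∞[γ+1]` and the `ψ₂`-coinvariants `Sel♭_∞/(γ+1)` are finite then `f(−2) ≠ 0` and
`v₂ f(−2) = log₂ #Sel♭_∞[γ+1] − log₂ #Sel♭_∞/(γ+1)`.  Statement = the body of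
`OddBlindPackage.FlatBlindEulerCharAtTwo` verbatim.  Proof: Greenberg's Lemma 4.2 for the dual pair
twisted by `T ↦ T + 2`. [cite: GreenbergLNM1716, §4 Lemma 4.2]
[cite: CoatesSchneiderSujatha2003, §3 (30)–(31) p. 199] -/
theorem flatBlindEulerCharAtTwo :
  ∀ (W : WeierstrassCurve ℚ) [W.IsElliptic] [W.IsGloballyMinimal], GoodSS W 2 →
  ∀ (κ : ZpExtension ℚ 2) (γ : Field.absoluteGaloisGroup ℚ),
    κ.IsCyclotomic → κ.IsTopGenerator γ → IsCyclotomicVariable 2 γ →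
  ∀ (v : HeightOneSpectrum (𝓞 ℚ)), (2 : 𝓞 ℚ) ∈ v.asIdeal →
  ∀ (g : Field.absoluteGaloisGroup (v.adicCompletion ℚ)) (c : ℕ → localPoints W (v.adicCompletion ℚ)),
    κ.IsTopGenerator (resGalOfEmb (closureEmb (K := ℚ) (v.adicCompletion ℚ)) g) →
  ∀ (D : SharpFlatSelmerDualData W κ γ (closureEmb (K := ℚ) (v.adicCompletion ℚ))
      (W.frobeniusTrace 2) g c .flat) [Module.Finite (IwasawaAlgebra 2) D.X],
    Module.IsTorsion (IwasawaAlgebra 2) D.X →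
  ∀ f : IwasawaAlgebra 2, D.charIdeal = Ideal.span {f} →
    Finite (endInvariants (conjSharpFlatSelmerInfty W κ (closureEmb (K := ℚ) (v.adicCompletion ℚ))
      (W.frobeniusTrace 2) g c .flat γ + 1)) →
    Finite (EndCoinvariants (conjSharpFlatSelmerInfty W κ (closureEmb (K := ℚ) (v.adicCompletion ℚ))
      (W.frobeniusTrace 2) g c .flat γ + 1)) →
    evalAt (-2 : ℤ_[2]) f ≠ 0 ∧
    ((evalAt (-2 : ℤ_[2]) f).valuation : ℤ) =
      (padicValNat 2 (Nat.card (endInvariants (conjSharpFlatSelmerInfty W κ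
          (closureEmb (K := ℚ) (v.adicCompletion ℚ)) (W.frobeniusTrace 2) g c .flat γ + 1))) : ℤ) -
        (padicValNat 2 (Nat.card (EndCoinvariants (conjSharpFlatSelmerInfty W κ
          (closureEmb (K := ℚ) (v.adicCompletion ℚ)) (W.frobeniusTrace 2) g c .flat γ + 1))) : ℤ) := by
  intro W _ _ _hss κ γ _hκ hγ _hγ' v _hv g c _hg D _ htors f hf hfinI hfinC
  -- (1) the dual pair `T ↔ conj_γ - 1` of the ♭ datum (Sprung 2024 chromatic control file)
  have hpair := D.isDualPair hγ
  -- (2) twist by `n = 2 = p`: `T + 2 ↔ (conj_γ - 1) + 2 = conj_γ + 1`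
  have h2 : (2 : ℕ) ∣ 2 := dvd_rfl
  have htw := isDualPair_twisted hpair h2
  have hψ : conjSharpFlatSelmerInfty W κ (closureEmb (K := ℚ) (v.adicCompletion ℚ)) (W.frobeniusTrace 2) g c
        .flat γ - 1 + ((2 : ℕ) : AddMonoid.End _) =
      conjSharpFlatSelmerInfty W κ (closureEmb (K := ℚ) (v.adicCompletion ℚ)) (W.frobeniusTrace 2) g c
        .flat γ + 1 := by
    rw [Nat.cast_ofNat, sub_add_eq_add_sub, add_sub_assoc]
    norm_num
  rw [hψ] at htw
  -- (3) the twisted module is finitely generated torsion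
  have t2 : ‖((2 : ℕ) : ℤ_[2])‖ < 1 := norm_natCast_lt_one_of_dvd h2
  haveI : Module.Finite (IwasawaAlgebra 2) (Twisted t2 D.X) := moduleFinite_twisted t2
  have htors' : Module.IsTorsion (IwasawaAlgebra 2) (Twisted t2 D.X) := isTorsion_twisted t2 htors
  -- (4) its characteristic ideal is `τ_{-2}(char X♭) = (τ_{-2} f)` (transport along the semilinear `toTwisted`)
  have hchar : Literature.NumberTheory.EllipticCurves.Module.charIdeal (IwasawaAlgebra 2) (Twisted t2 D.X) =
      Ideal.span {translate (norm_neg_lt_one t2) f} := by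
    have key := Literature.NumberTheory.EllipticCurves.Module.charIdeal_eq_map_of_semilinearEquiv
      ((translateEquiv t2).symm.toRingEquiv) (M := D.X) (N := Twisted t2 D.X) (toTwisted t2 (X := D.X)) ?_
    · rw [key]
      have hf' : Literature.NumberTheory.EllipticCurves.Module.charIdeal (IwasawaAlgebra 2) D.X =
          Ideal.span {f} := hf
      rw [hf', Ideal.map_span, Set.image_singleton]
      rfl
    · intro r m
      change toTwisted t2 (r • m) = translate (norm_neg_lt_one t2) r • toTwisted t2 m
      rw [smul_toTwisted, translate_translate_neg]
  -- (5) Greenberg's Lemma 4.2 for the twisted pair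
  obtain ⟨u, hu⟩ := htw.constantCoeff_charGenerator_mul_natCard_endCoinvariants htors'
    (translate (norm_neg_lt_one t2) f) hchar hfinI
  have hne := (htw.order_charGenerator_eq_zero_of_finite_endInvariants htors'
    (translate (norm_neg_lt_one t2) f) hchar hfinI).2
  -- (6) `(τ_{-2} f)(0) = f(-2)`
  have hval : PowerSeries.constantCoeff (translate (norm_neg_lt_one t2) f) = evalAt (-2 : ℤ_[2]) f := by
    rw [constantCoeff_translate]
    simp only [Nat.cast_ofNat]
    rfl
  rw [hval] at hu hne
  -- (7) valuations
  refine ⟨hne, ?_⟩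
  haveI := hfinI
  haveI := hfinC
  have hI0 : Nat.card (endInvariants (conjSharpFlatSelmerInfty W κ (closureEmb (K := ℚ) (v.adicCompletion ℚ))
      (W.frobeniusTrace 2) g c .flat γ + 1)) ≠ 0 := Nat.card_pos.ne'
  have hC0 : Nat.card (EndCoinvariants (conjSharpFlatSelmerInfty W κ (closureEmb (K := ℚ) (v.adicCompletion ℚ))
      (W.frobeniusTrace 2) g c .flat γ + 1)) ≠ 0 := Nat.card_pos.ne'
  have hv := congrArg PadicInt.valuation hu
  rw [PadicInt.valuation_mul hne (Nat.cast_ne_zero.mpr hC0),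
    PadicInt.valuation_mul (Units.ne_zero u) (Nat.cast_ne_zero.mpr hI0), valuation_units, zero_add,
    valuation_natCast, valuation_natCast] at hv
  omega

end OddBlindEC

end Summit.BirchSwinnertonDyer.BirchSwinnertonDyer.Theorems

end
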